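import Summits.QuantumAdvantage.QuantumAdvantage.Theorems.CubicForrelationNearExactIsExactTwoModSixSecondDigits
import Summits.QuantumAdvantage.QuantumAdvantage.Theorems.CubicForrelationNearExactIsExactFourteenSecondTypeOLowRank
import Summits.QuantumAdvantage.QuantumAdvantage.Theorems.CubicForrelationNearExactIsExactTwoModSixPrep

/-!
# Crux `CubicForrelation.NearExactIsExact` (stmt-QuantumAdvantage-14043) — `n = 6r+2` at the second boundary `1 − 2^{−2r}`, type O with a
  first digit of rank `≤ 2`: the configuration `{d₁ ≠ d₂} ≠ ∅` is impossible, for every Boolean partner (`r ≥ 3`)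

Certificate seat `b2b-cforr-cert` (gen 9).  HONEST FRAMING: a theorem uniform in `r` about cubic Boolean functions on `6r+2` bits, `r ≥ 3` —
the general-`r` twin of the 14-bit `fo_lowrank_false` (at `r = 2` the shift `4s ≡ 4 (mod 8)` swaps the digit classes; for `r ≥ 3`,
`2^r s ≡ 0 (mod 8)` and the expensive class is `A = {d₁ ≠ d₂}`) — NOT summit progress.

`W_g = 2^{2r+1}u`, `u` odd; `τ = u − 2^r s`; budget `Στ² = 2^{8r+3}(1−Φ) ≤ 2^{6r+3} = 2N` (`tms_budget`); `τ² ≥ 1 + 8·[d₁ ≠ d₂]` (`z2_pt`);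
with `#rad(d₁) ≥ 2^{6r}` the digit `d₂` is cubic (`tm2_digitTwo_cubic`), so `A = supp(d₁ ⊕ d₂) ≠ ∅` has `#A ≥ 2^{6r−1} = N/8` (Reed–Muller), the
budget is spent exactly, `A` is a `(6r−1)`-flat, `τ = (−1)^{d₁}(1 − 4·1_A)` (`z2_tau_one/three`), and the period engine (`fp_l1_sq_mul_le` with
`rad(d₁)` and `rad(d₁) ∩ V_A` of size `≥ 2^{6r−3}`, `fo_card_mul_le_inter`) gives `Σ|τ̂| ≤ 5·2^{6r+3} < 2^{8r+3} = Σ_y (−1)^g τ̂(y)`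
(`tms_pairing`).  `tm2_lowrank_false`.

References: as in the imported files.  Everything below is proved from Mathlib and the tree; axioms are the standard three.
-/

set_option linter.dupNamespace false -- D-0017: single-problem summit ⇒ `QuantumAdvantage.QuantumAdvantage` by design

noncomputable section

namespace Summit.QuantumAdvantage.QuantumAdvantage.Theorems.CubicForrelation.NearExactIsExact

open Finset
open Literature.Computability.QuantumComplexity
open Literature.Computability.QuantumComplexity.BuzetChailloux (bxor zeroVec bxor_bxor_cancel_left bxor_zeroVec zeroVec_bxor bxor_comm
  bxor_self)
open Literature.Computability.QuantumComplexity.DerivativeWalsh (W)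

/-- **Type O with `rank d₁ ≤ 2` and `{d₁ ≠ d₂} ≠ ∅` never reaches `Φ = 1 − 2^{−2r}` on `6r+2` bits (`r ≥ 3`), for every Boolean `f`.**
Uniform in `r`; NOT summit progress. [this work] -/
theorem tm2_lowrank_false (r : ℕ) (hr : 3 ≤ r) (f g : (Fin ((3 * r + 1) + (3 * r + 1)) → Bool) → Bool) (hg : IsDegLeFun 3 g)
    (u : (Fin ((3 * r + 1) + (3 * r + 1)) → Bool) → ℤ) (hu : ∀ x, W (fun y => signOf (g y)) x = (2 : ℝ) ^ (2 * r + 1) * (u x : ℝ))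
    (hodd : ∀ x, Odd (u x))
    (hrad : 2 ^ (6 * r) ≤ #(univ.filter fun a : Fin ((3 * r + 1) + (3 * r + 1)) → Bool => ∀ b,
      (decide (Odd (u zeroVec / 2)) ^^ decide (Odd (u a / 2)) ^^ decide (Odd (u b / 2)) ^^ decide (Odd (u (bxor a b) / 2))) = false))
    (hAne : ∃ x, ¬ (Odd (u x / 2) ↔ Odd (u x / 2 / 2)))
    (hΦ : 1 - (1 / 2 : ℝ) ^ (2 * r) ≤ forrelation f g) : False := by
  classical
  have hd1 : IsDegLeFun 2 (fun x => decide (Odd (u x / 2))) := tm2_digitOne r g u hg hu hodd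
  have hd2 : IsDegLeFun 3 (fun x => decide (Odd (u x / 2 / 2))) := tm2_digitTwo_cubic r g u hg hu hodd hrad
  obtain ⟨k, rfl⟩ : ∃ k, r = k + 3 := ⟨r - 3, by omega⟩
  set R := univ.filter (fun a : Fin ((3 * (k + 3) + 1) + (3 * (k + 3) + 1)) → Bool => ∀ b,
      (decide (Odd (u zeroVec / 2)) ^^ decide (Odd (u a / 2)) ^^ decide (Odd (u b / 2)) ^^ decide (Odd (u (bxor a b) / 2))) = false)
    with hRdef
  have h0R : zeroVec ∈ R := by
    refine mem_filter.2 ⟨mem_univ _, fun b => ?_⟩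
    rw [zeroVec_bxor]
    cases decide (Odd (u zeroVec / 2)) <;> cases decide (Odd (u b / 2)) <;> rfl
  have haddR : ∀ a ∈ R, ∀ a' ∈ R, bxor a a' ∈ R := by
    intro a ha a' ha'
    refine mem_filter.2 ⟨mem_univ _, fun b => ?_⟩
    rw [es_B_add_left (fun x => decide (Odd (u x / 2))) hd1 a a' b, (mem_filter.1 ha).2 b, (mem_filter.1 ha').2 b]
    rfl
  have hDR : ∀ a ∈ R, ∀ x : Fin ((3 * (k + 3) + 1) + (3 * (k + 3) + 1)) → Bool,
      decide (Odd (u (bxor x a) / 2)) = (decide (Odd (u x / 2)) ^^ (decide (Odd (u zeroVec / 2)) ^^ decide (Odd (u a / 2)))) := by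
    intro a ha x
    have h := (mem_filter.1 ha).2 x
    rw [bxor_comm] at h
    revert h
    cases decide (Odd (u zeroVec / 2)) <;> cases decide (Odd (u a / 2)) <;> cases decide (Odd (u x / 2)) <;>
      cases decide (Odd (u (bxor x a) / 2)) <;> decide
  -- the set `A = {d₁ ≠ d₂}` and its degree
  set A := univ.filter (fun x : Fin ((3 * (k + 3) + 1) + (3 * (k + 3) + 1)) → Bool => ¬ (Odd (u x / 2) ↔ Odd (u x / 2 / 2))) with hAdef
  have hmemA : ∀ x, x ∈ A ↔ ¬ (Odd (u x / 2) ↔ Odd (u x / 2 / 2)) := fun x => by simp [hAdef]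
  have hdegA : IsDegLeFun (2 + 1) (fun x => decide (Odd (u x / 2)) ^^ decide (Odd (u x / 2 / 2))) :=
    bb_isDegLeFun_bxor (hd1.mono (by norm_num)) hd2
  have hsetA : (univ.filter fun x : Fin ((3 * (k + 3) + 1) + (3 * (k + 3) + 1)) → Bool =>
      (decide (Odd (u x / 2)) ^^ decide (Odd (u x / 2 / 2))) = true) = A := by
    rw [hAdef]
    apply filter_congr
    intro x _
    by_cases h1 : Odd (u x / 2) <;> by_cases h2 : Odd (u x / 2 / 2) <;> simp [h1, h2]
  have hne : ∃ x, (decide (Odd (u x / 2)) ^^ decide (Odd (u x / 2 / 2))) = true := by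
    obtain ⟨x, hx⟩ := hAne
    refine ⟨x, ?_⟩
    by_cases h1 : Odd (u x / 2) <;> by_cases h2 : Odd (u x / 2 / 2) <;> simp [h1, h2] at hx ⊢
  have hrm := bb_rmWeight_holds ((3 * (k + 3) + 1) + (3 * (k + 3) + 1)) 3 _ hdegA hne
  rw [hsetA] at hrm
  have hN : (2 : ℕ) ^ ((3 * (k + 3) + 1) + (3 * (k + 3) + 1)) = 2 ^ 3 * 2 ^ (6 * k + 17) := by ring
  have hAge : 2 ^ (6 * k + 17) ≤ #A := by rw [hN] at hrm; exact Nat.le_of_mul_le_mul_left hrm (by positivity)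
  -- budget and the pointwise cost
  have hbud := tms_budget (k + 3) f g u hu
  have hpow : (2 : ℝ) ^ (8 * (k + 3) + 3) * (1 / 2) ^ (2 * (k + 3)) = 2 ^ (6 * k + 21) := by
    rw [one_div_pow]; field_simp; ring
  have hT : (∑ x, (u x - 2 ^ (k + 3) * sZ (f x)) ^ 2 : ℤ) ≤ 2 ^ (6 * k + 21) := by
    have h1 : 1 - forrelation f g ≤ (1 / 2 : ℝ) ^ (2 * (k + 3)) := by linarith
    have h' : ((∑ x, (u x - 2 ^ (k + 3) * sZ (f x)) ^ 2 : ℤ) : ℝ) ≤ (2 : ℝ) ^ (6 * k + 21) := by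
      rw [hbud, ← hpow]
      exact mul_le_mul_of_nonneg_left h1 (by positivity)
    exact_mod_cast h'
  have hsumA : (∑ x, (if ¬ (Odd (u x / 2) ↔ Odd (u x / 2 / 2)) then 1 else 0 : ℤ)) = #A := by rw [sum_boole]
  have hnonneg : ∀ x, 0 ≤ (u x - 2 ^ (k + 3) * sZ (f x)) ^ 2 - (1 + 8 * (if ¬ (Odd (u x / 2) ↔ Odd (u x / 2 / 2)) then 1 else 0 : ℤ)) :=
    fun x => by
      have := z2_pt (u x) (sZ (f x)) (2 ^ (k + 3)) (hodd x) (tp_sZ_cases (f x)) ⟨2 ^ k, by ring⟩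
      linarith
  have hNcard : #(univ : Finset (Fin ((3 * (k + 3) + 1) + (3 * (k + 3) + 1)) → Bool)) = 2 ^ (6 * k + 20) := by
    rw [card_univ, Fintype.card_fun, Fintype.card_bool, Fintype.card_fin]; ring
  have hAge' : (2 : ℤ) ^ (6 * k + 17) ≤ #A := by exact_mod_cast hAge
  have hsum0 : ∑ x, ((u x - 2 ^ (k + 3) * sZ (f x)) ^ 2 - (1 + 8 * (if ¬ (Odd (u x / 2) ↔ Odd (u x / 2 / 2)) then 1 else 0 : ℤ))) = 0 := by
    refine le_antisymm ?_ (sum_nonneg fun x _ => hnonneg x)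
    rw [sum_sub_distrib, sum_add_distrib, ← mul_sum, hsumA, sum_const, hNcard, nsmul_eq_mul, mul_one]
    push_cast
    have e : (2 : ℤ) ^ (6 * k + 21) = 2 ^ (6 * k + 20) + 8 * 2 ^ (6 * k + 17) := by ring
    linarith
  have hpt : ∀ x, (u x - 2 ^ (k + 3) * sZ (f x)) ^ 2 = 1 + 8 * (if ¬ (Odd (u x / 2) ↔ Odd (u x / 2 / 2)) then 1 else 0 : ℤ) :=
    fun x => by have := (sum_eq_zero_iff_of_nonneg fun y _ => hnonneg y).1 hsum0 x (mem_univ x); linarith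
  have hAcard : #A = 2 ^ (6 * k + 17) := by
    have e : (∑ x, (u x - 2 ^ (k + 3) * sZ (f x)) ^ 2 : ℤ) = 2 ^ (6 * k + 20) + 8 * #A := by
      rw [sum_congr rfl fun x _ => hpt x, sum_add_distrib, ← mul_sum, hsumA, sum_const, hNcard, nsmul_eq_mul, mul_one]
      push_cast; ring
    have hle : (#A : ℤ) ≤ 2 ^ (6 * k + 17) := by
      have : (2 : ℤ) ^ (6 * k + 20) + 8 * #A ≤ 2 ^ (6 * k + 21) := by rw [← e]; exact hT
      have e2 : (2 : ℤ) ^ (6 * k + 21) = 2 ^ (6 * k + 20) + 8 * 2 ^ (6 * k + 17) := by ring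
      linarith
    have hle' : #A ≤ 2 ^ (6 * k + 17) := by exact_mod_cast hle
    exact le_antisymm hle' hAge
  have hTeq : (2 : ℝ) ^ (8 * (k + 3) + 3) * (1 - forrelation f g) = 2 ^ (6 * k + 21) := by
    have e : (∑ x, (u x - 2 ^ (k + 3) * sZ (f x)) ^ 2 : ℤ) = 2 ^ (6 * k + 21) := by
      rw [sum_congr rfl fun x _ => hpt x, sum_add_distrib, ← mul_sum, hsumA, sum_const, hNcard, hAcard, nsmul_eq_mul, mul_one]
      push_cast; ring
    have h : ((∑ x, (u x - 2 ^ (k + 3) * sZ (f x)) ^ 2 : ℤ) : ℝ) = 2 ^ (6 * k + 21) := by exact_mod_cast e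
    rw [hbud] at h
    exact h
  -- the residual
  have hc4 : (4 : ℤ) ∣ 2 ^ (k + 3) * 1 := ⟨2 ^ (k + 1), by ring⟩
  have hτ1 : ∀ x, x ∉ A → u x - 2 ^ (k + 3) * sZ (f x) = sZ (decide (Odd (u x / 2))) := by
    intro x hx
    have h := hpt x
    rw [if_neg (fun h' => hx ((hmemA x).2 h'))] at h
    have h1 : (u x - 2 ^ (k + 3) * sZ (f x)) * (u x - 2 ^ (k + 3) * sZ (f x)) = 1 := by rw [← pow_two]; linarith
    exact z2_tau_one (c := 2 ^ (k + 3)) (s := sZ (f x)) ⟨2 ^ (k + 1) * sZ (f x), by ring⟩ (mul_self_eq_one_iff.1 h1)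
  have hτ3 : ∀ x, x ∈ A → u x - 2 ^ (k + 3) * sZ (f x) = -3 * sZ (decide (Odd (u x / 2))) := by
    intro x hx
    have h := hpt x
    rw [if_pos ((hmemA x).1 hx)] at h
    exact z2_tau_three (c := 2 ^ (k + 3)) (s := sZ (f x)) ⟨2 ^ (k + 1) * sZ (f x), by ring⟩ (by linarith)
  -- `A` is a `(6r−1)`-flat
  have hmwA := mw_flat_of_minweight 2 _ hdegA (by rw [hsetA, hAcard]; ring)
  rw [hsetA] at hmwA
  obtain ⟨h0A, haddA, hcardVA, hcosetA⟩ := hmwA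
  set VA := univ.filter (fun a : Fin ((3 * (k + 3) + 1) + (3 * (k + 3) + 1)) → Bool => ∀ x,
    (decide (Odd (u (bxor x a) / 2)) ^^ decide (Odd (u (bxor x a) / 2 / 2))) =
      (decide (Odd (u x / 2)) ^^ decide (Odd (u x / 2 / 2)))) with hVA
  rw [hAcard] at hcardVA
  obtain ⟨xA, hxA⟩ := hAne
  have hxA' : xA ∈ A := (hmemA xA).2 hxA
  have hSA : A = VA.image (bxor xA) := hcosetA xA (by
    by_cases h1 : Odd (u xA / 2) <;> by_cases h2 : Odd (u xA / 2 / 2) <;> simp [h1, h2] at hxA ⊢)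
  -- engine, part 1: `A₁ = (−1)^{d₁}` with `R`
  set A₁ : (Fin ((3 * (k + 3) + 1) + (3 * (k + 3) + 1)) → Bool) → ℝ := fun x => signOf (decide (Odd (u x / 2))) with hA₁
  have h1b := fp_l1_sq_mul_le A₁ univ R (fun x _ => by simp only [A₁]; unfold signOf; split_ifs <;> simp)
    (fun x hx => absurd (mem_univ x) hx) h0R haddR (fun a ha => by
      refine ⟨signOf (decide (Odd (u zeroVec / 2)) ^^ decide (Odd (u a / 2))), ?_, fun x => ?_⟩
      · unfold signOf; split_ifs <;> simp
      · simp only [A₁]; rw [hDR a ha x, signOf_xor]; ring)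
  rw [hNcard] at h1b
  have hRr : ((2 : ℝ) ^ (6 * (k + 3))) ≤ #R := by exact_mod_cast hrad
  have hX : ∑ y, |W A₁ y| ≤ (2 : ℝ) ^ (6 * k + 21) := by
    have hnn : 0 ≤ ∑ y, |W A₁ y| := sum_nonneg fun y _ => abs_nonneg _
    push_cast at h1b
    have h2 : (∑ y, |W A₁ y|) ^ 2 * (2 : ℝ) ^ (6 * (k + 3)) ≤ (∑ y, |W A₁ y|) ^ 2 * #R := mul_le_mul_of_nonneg_left hRr (sq_nonneg _)
    have h3 : (∑ y, |W A₁ y|) ^ 2 * (2 : ℝ) ^ (6 * (k + 3)) ≤ ((2 : ℝ) ^ (6 * k + 21)) ^ 2 * 2 ^ (6 * (k + 3)) := by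
      refine (h2.trans h1b).trans (le_of_eq ?_); ring
    exact (pow_le_pow_iff_left₀ hnn (by positivity) two_ne_zero).1 (le_of_mul_le_mul_right h3 (by positivity))
  -- part 2: `A₂ = 1_A·(−1)^{d₁}` with `R ∩ V_A`
  set A₂ : (Fin ((3 * (k + 3) + 1) + (3 * (k + 3) + 1)) → Bool) → ℝ :=
    fun x => if x ∈ A then signOf (decide (Odd (u x / 2))) else 0 with hA₂
  have hRV := fo_card_mul_le_inter R VA haddR haddA
  rw [hcardVA] at hRV
  have hR2 : 2 ^ (6 * k + 15) ≤ #(R ∩ VA) := by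
    have h1 : 2 ^ (6 * (k + 3)) * 2 ^ (6 * k + 17) ≤ 2 ^ ((3 * (k + 3) + 1) + (3 * (k + 3) + 1)) * #(R ∩ VA) :=
      (Nat.mul_le_mul_right _ hrad).trans hRV
    have e : (2 : ℕ) ^ (6 * (k + 3)) * 2 ^ (6 * k + 17) = 2 ^ ((3 * (k + 3) + 1) + (3 * (k + 3) + 1)) * 2 ^ (6 * k + 15) := by ring
    rw [e] at h1
    exact Nat.le_of_mul_le_mul_left h1 (by positivity)
  have h0R2 : zeroVec ∈ R ∩ VA := mem_inter.2 ⟨h0R, h0A⟩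
  have haddR2 : ∀ a ∈ R ∩ VA, ∀ b ∈ R ∩ VA, bxor a b ∈ R ∩ VA := fun a ha b hb =>
    mem_inter.2 ⟨haddR a (mem_inter.1 ha).1 b (mem_inter.1 hb).1, haddA a (mem_inter.1 ha).2 b (mem_inter.1 hb).2⟩
  have h2b := fp_l1_sq_mul_le A₂ A (R ∩ VA) (fun x hx => by
      simp only [A₂, if_pos hx]; unfold signOf; split_ifs <;> simp) (fun x hx => by simp only [A₂, if_neg hx]) h0R2 haddR2
    (fun a ha => by
      refine ⟨signOf (decide (Odd (u zeroVec / 2)) ^^ decide (Odd (u a / 2))), ?_, fun x => ?_⟩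
      · unfold signOf; split_ifs <;> simp
      · by_cases hx : x ∈ A
        · have hxa : bxor x a ∈ A := fl1_coset_vadd haddA hSA hx (mem_inter.1 ha).2
          simp only [A₂, if_pos hx, if_pos hxa]; rw [hDR a (mem_inter.1 ha).1 x, signOf_xor]; ring
        · have hxa : bxor x a ∉ A := fl1_coset_out' haddA hSA hx (mem_inter.1 ha).2
          simp only [A₂, if_neg hx, if_neg hxa, mul_zero])
  rw [hAcard] at h2b
  have hR2r : ((2 : ℝ) ^ (6 * k + 15)) ≤ #(R ∩ VA) := by exact_mod_cast hR2
  have hY : ∑ y, |W A₂ y| ≤ (2 : ℝ) ^ (6 * k + 21) := by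
    have hnn : 0 ≤ ∑ y, |W A₂ y| := sum_nonneg fun y _ => abs_nonneg _
    push_cast at h2b
    have h2 : (∑ y, |W A₂ y|) ^ 2 * (2 : ℝ) ^ (6 * k + 15) ≤ (∑ y, |W A₂ y|) ^ 2 * #(R ∩ VA) :=
      mul_le_mul_of_nonneg_left hR2r (sq_nonneg _)
    have h3 : (∑ y, |W A₂ y|) ^ 2 * (2 : ℝ) ^ (6 * k + 15) ≤ ((2 : ℝ) ^ (6 * k + 21)) ^ 2 * 2 ^ (6 * k + 15) := by
      refine (h2.trans h2b).trans (le_of_eq ?_)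
      rw [show ((3 * (k + 3) + 1) + (3 * (k + 3) + 1)) = 6 * k + 20 by ring]; ring
    exact (pow_le_pow_iff_left₀ hnn (by positivity) two_ne_zero).1 (le_of_mul_le_mul_right h3 (by positivity))
  -- decomposition and pairing
  have hdecomp : (fun x => (u x : ℝ) - (2 : ℝ) ^ (k + 3) * signOf (f x)) = fun x => A₁ x + (-4) * A₂ x := by
    funext x
    have e : (u x : ℝ) - (2 : ℝ) ^ (k + 3) * signOf (f x) = (((u x - 2 ^ (k + 3) * sZ (f x) : ℤ)) : ℝ) := by
      push_cast; rw [tp_sZ_cast]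
    rw [e]
    by_cases hx : x ∈ A
    · simp only [A₁, A₂, if_pos hx]; rw [hτ3 x hx]; push_cast; rw [tp_sZ_cast]; ring
    · simp only [A₁, A₂, if_neg hx]; rw [hτ1 x hx, tp_sZ_cast]; ring
  have hpair := tms_pairing (k + 3) f g u hu
  rw [show (2 : ℝ) ^ (10 * (k + 3) + 3) = 2 ^ (2 * k + 6) * 2 ^ (8 * (k + 3) + 3) by ring, mul_assoc, hTeq, hdecomp] at hpair
  have e2 : ∀ y, signOf (g y) * W (fun x => A₁ x + (-4) * A₂ x) y =
      signOf (g y) * W A₁ y + (-4) * (signOf (g y) * W A₂ y) := fun y => by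
    rw [sp_W_add, fl1_W_smul]; ring
  rw [sum_congr rfl fun y _ => e2 y, sum_add_distrib, ← mul_sum] at hpair
  have hP1 : ∑ y, signOf (g y) * W A₁ y ≤ ∑ y, |W A₁ y| := fl1_pairing_le_l1 g (W A₁)
  have hP2 : |∑ y, signOf (g y) * W A₂ y| ≤ ∑ y, |W A₂ y| :=
    (abs_sum_le_sum_abs _ _).trans (sum_le_sum fun y _ => by
      rw [abs_mul]; unfold signOf; split_ifs <;> norm_num)
  have hP2' := (abs_le.1 hP2).1
  have h23 : (2 : ℝ) ^ (2 * k + 6) * 2 ^ (6 * k + 21) = 2 ^ (8 * k + 27) := by ring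
  rw [h23] at hpair
  have hbig : (2 : ℝ) ^ (6 * k + 21) + 4 * 2 ^ (6 * k + 21) < 2 ^ (8 * k + 27) := by
    have e : (2 : ℝ) ^ (8 * k + 27) = 2 ^ (6 * k + 21) * 2 ^ (2 * k + 6) := by ring
    have h64 : (64 : ℝ) ≤ 2 ^ (2 * k + 6) := by
      have : (2 : ℝ) ^ 6 ≤ 2 ^ (2 * k + 6) := pow_le_pow_right₀ (by norm_num) (by omega)
      norm_num at this; exact this
    have hpos : (0 : ℝ) < 2 ^ (6 * k + 21) := by positivity
    have hm : (2 : ℝ) ^ (6 * k + 21) * 64 ≤ 2 ^ (6 * k + 21) * 2 ^ (2 * k + 6) := mul_le_mul_of_nonneg_left h64 hpos.le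
    rw [e]; linarith
  linarith

end Summit.QuantumAdvantage.QuantumAdvantage.Theorems.CubicForrelation.NearExactIsExact

end
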